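import Summits.ResolutionOfSingularities.ResolutionOfSingularities.Theses.WeightedInvariant
import Summits.ResolutionOfSingularities.ResolutionOfSingularities.Theorems.WeightedInvariantHypersurfaceCentreChoiceToDatum
import Summits.ResolutionOfSingularities.ResolutionOfSingularities.Theorems.WeightedInvariantHypersurfaceDatumToChoice
import HarnessLib

/-!
# The door `HypersurfaceCentreConstruction` ⟺ hypersurface centre CHOICES with centres in the singular locus

Route `ResolutionOfSingularities/WeightedInvariant`, crux `Theses.WeightedInvariant.HypersurfaceCentreConstruction`
(stmt-ResolutionOfSingularities-19897: `∀ p prime, Nonempty (HypersurfaceTerminatingCentreDatum p)`), door line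
`local-engine`, CRUX-PLAN r1 of `res-L1-w43-plan-1` (sketch `door_globalize_sketch.lean` 4548141fdf78465f).
Composition of the two packaging helpers H1 (`Theorems/…HypersurfaceCentreChoiceToDatum.lean`:
choice with centres under the non-regular locus ⇒ datum) and H1c (`Theorems/…HypersurfaceDatumToChoice.lean`:
datum ⇒ choice, same centre): the door item is EQUIVALENT, prime by prime, to the existence of a
`HypersurfaceCentreChoice p` (RESHAPE 9's functoriality-free interface: `(iii)` regular weighted centre,
`(ii′)` generic point off the support, `(H)` torus-homogeneity, `(T)` well-founded tower step) whose centres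
lie in the image of the non-regular locus of the hypersurface (`singImage`, condition `(iii-b′)`) —
`nonempty_hypersurfaceTerminatingCentreDatum_iff_exists_choice`,
`hypersurfaceCentreConstruction_iff_forall_exists_choice`.  So the CONTENT of the door (H2 `(G-glob)` of the
sketch) is pinned BY NAME to the route item: what remains to be constructed is such a choice, nothing more
(no rating, no rank, no canonicity across pairs).  Nothing here asserts either side; no `Nonempty` is
claimed unconditionally.
-/

noncomputable section

open CategoryTheory AlgebraicGeometry TopologicalSpace
open Literature.AlgebraicGeometry.Resolution
open Summit.ResolutionOfSingularities.ResolutionOfSingularities.Theses.WeightedInvariant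

set_option linter.dupNamespace false -- mandated namespace of this single-conjunct summit

namespace Summit.ResolutionOfSingularities.ResolutionOfSingularities.Theorems

namespace HypersurfaceTerminatingCentreDatum

variable {p : ℕ} (E : HypersurfaceTerminatingCentreDatum p)

/-- **`(iii-b′)` through `(ii)`: the non-minimal locus of the rating IS the image of the non-regular
locus** — on a hypersurface pair, `E.inv f X y` is not minimal iff `y ∈ singImage X`. [folklore] -/
theorem not_isBot_inv_iff_mem_singImage {k : Type} [Field k] [CharP k p] [PerfectField k]
    {Y : Scheme.{0}} (f : Y ⟶ Spec (.of k)) [Smooth f] [IsSeparated f] [QuasiCompact f]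
    (X : Y.IdealSheafData) (hX : IsLocallyPrincipal X) (hXi : IsIntegral X.subscheme) (y : Y) :
    ¬ IsBot (E.inv f X y) ↔ y ∈ singImage X := by
  rw [E.isBot_inv_iff f X hX hXi y]
  simp only [singImage, Set.mem_setOf_eq]
  push Not
  rfl

/-- **The centre of the datum — hence of the choice `E.toChoice` — lies in the image of the non-regular
locus** (`(iii-b′)` + `(ii)`): the hypothesis `hsupp` of H1 holds for `E.toChoice`. [folklore] -/
theorem support_centre_subset_singImage {k : Type} [Field k] [CharP k p] [PerfectField k]
    {Y : Scheme.{0}} (f : Y ⟶ Spec (.of k)) [Smooth f] [IsSeparated f] [QuasiCompact f]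
    (X : Y.IdealSheafData) (hX : IsLocallyPrincipal X) (hXi : IsIntegral X.subscheme)
    (hsing : ¬ Scheme.IsRegular X.subscheme) : (E.centre f X).support ⊆ singImage X :=
  fun y hy => (E.not_isBot_inv_iff_mem_singImage f X hX hXi y).mp
    (E.support_centre_subset f X hX hXi (E.exists_not_isBot_inv_of_not_isRegular f X hX hXi hsing) hy)

/-- The same for the choice `E.toChoice` (its centre is `E.centre`). [folklore] -/
theorem support_toChoice_centre_subset_singImage :
    ∀ ⦃k : Type⦄ [Field k] [CharP k p] [PerfectField k] ⦃Y : Scheme.{0}⦄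
      (f : Y ⟶ Spec (.of k)) [Smooth f] [IsSeparated f] [QuasiCompact f] (X : Y.IdealSheafData),
      IsLocallyPrincipal X → IsIntegral X.subscheme → ¬ Scheme.IsRegular X.subscheme →
      (E.toChoice.centre f X).support ⊆ singImage X :=
  fun _ _ _ _ _ f _ _ _ X hX hXi hsing => E.support_centre_subset_singImage f X hX hXi hsing

end HypersurfaceTerminatingCentreDatum

/-- **Prime by prime: a hypersurface terminating centre datum exists iff a hypersurface centre choice
with centres in the singular locus exists** (H1 ⟸ `nonempty_hypersurfaceTerminatingCentreDatum_of_choice`;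
⟹ H1c `HypersurfaceTerminatingCentreDatum.toChoice` with `(iii-b′)` carried through `(ii)`). [folklore] -/
theorem nonempty_hypersurfaceTerminatingCentreDatum_iff_exists_choice (p : ℕ) :
    Nonempty (HypersurfaceTerminatingCentreDatum p) ↔
      ∃ C : HypersurfaceCentreChoice p,
        ∀ ⦃k : Type⦄ [Field k] [CharP k p] [PerfectField k] ⦃Y : Scheme.{0}⦄
          (f : Y ⟶ Spec (.of k)) [Smooth f] [IsSeparated f] [QuasiCompact f] (X : Y.IdealSheafData),
          IsLocallyPrincipal X → IsIntegral X.subscheme → ¬ Scheme.IsRegular X.subscheme →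
          (C.centre f X).support ⊆ singImage X := by
  constructor
  · rintro ⟨E⟩
    exact ⟨E.toChoice, E.support_toChoice_centre_subset_singImage⟩
  · rintro ⟨C, hC⟩
    exact nonempty_hypersurfaceTerminatingCentreDatum_of_choice p C hC

/-- **Choices at every prime give the door item** `HypersurfaceCentreConstruction` (H1, prime by
prime). [folklore] -/
theorem hypersurfaceCentreConstruction_of_forall_exists_choice
    (h : ∀ p : ℕ, p.Prime → ∃ C : HypersurfaceCentreChoice p,
      ∀ ⦃k : Type⦄ [Field k] [CharP k p] [PerfectField k] ⦃Y : Scheme.{0}⦄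
        (f : Y ⟶ Spec (.of k)) [Smooth f] [IsSeparated f] [QuasiCompact f] (X : Y.IdealSheafData),
        IsLocallyPrincipal X → IsIntegral X.subscheme → ¬ Scheme.IsRegular X.subscheme →
        (C.centre f X).support ⊆ singImage X) :
    HypersurfaceCentreConstruction :=
  fun p hp => (nonempty_hypersurfaceTerminatingCentreDatum_iff_exists_choice p).mpr (h p hp)

/-- **The door item gives choices with centres in the singular locus at every prime** (H1c, prime by
prime). [folklore] -/
theorem forall_exists_choice_of_hypersurfaceCentreConstruction (h : HypersurfaceCentreConstruction) :
    ∀ p : ℕ, p.Prime → ∃ C : HypersurfaceCentreChoice p,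
      ∀ ⦃k : Type⦄ [Field k] [CharP k p] [PerfectField k] ⦃Y : Scheme.{0}⦄
        (f : Y ⟶ Spec (.of k)) [Smooth f] [IsSeparated f] [QuasiCompact f] (X : Y.IdealSheafData),
        IsLocallyPrincipal X → IsIntegral X.subscheme → ¬ Scheme.IsRegular X.subscheme →
        (C.centre f X).support ⊆ singImage X :=
  fun p hp => (nonempty_hypersurfaceTerminatingCentreDatum_iff_exists_choice p).mp (h p hp)

/-- **The door `HypersurfaceCentreConstruction` (stmt-19897) is EQUIVALENT to: at every prime `p`, a
hypersurface centre choice with centres in the singular locus** — the re-typing of the door's content BY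
NAME (H1 ∘ H1c). [folklore] -/
theorem hypersurfaceCentreConstruction_iff_forall_exists_choice :
    HypersurfaceCentreConstruction ↔
      ∀ p : ℕ, p.Prime → ∃ C : HypersurfaceCentreChoice p,
        ∀ ⦃k : Type⦄ [Field k] [CharP k p] [PerfectField k] ⦃Y : Scheme.{0}⦄
          (f : Y ⟶ Spec (.of k)) [Smooth f] [IsSeparated f] [QuasiCompact f] (X : Y.IdealSheafData),
          IsLocallyPrincipal X → IsIntegral X.subscheme → ¬ Scheme.IsRegular X.subscheme →
          (C.centre f X).support ⊆ singImage X :=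
  ⟨forall_exists_choice_of_hypersurfaceCentreConstruction, hypersurfaceCentreConstruction_of_forall_exists_choice⟩

/-- **In particular the door implies RESHAPE 9's door** `∀ p prime, Nonempty (HypersurfaceCentreChoice p)`
(forget `(iii-b′)`), the hypothesis of `weightedThesis_of_hypersurfaceChoice_of_forall_berghRydh_charP`.
[folklore] -/
theorem forall_nonempty_choice_of_hypersurfaceCentreConstruction (h : HypersurfaceCentreConstruction) :
    ∀ p : ℕ, p.Prime → Nonempty (HypersurfaceCentreChoice p) :=
  fun p hp => nonempty_choice_of_hypersurfaceTerminatingCentreDatum p (h p hp).some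

end Summit.ResolutionOfSingularities.ResolutionOfSingularities.Theorems

end
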